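import Literature.AlgebraicTopology.SingularHomology.EilenbergSubcomplex
import Literature.AlgebraicTopology.SingularHomology.PrismIdentity
import Literature.AlgebraicTopology.SingularHomology.HomDualComplex
import Literature.Geometry.Kaehler.ChartTransport
import Mathlib.Algebra.Ring.GeomSum
import HarnessLib

/-!
# The chart-cone prism: contracting the (smooth) singular chains of a chart-convex set

Third brick of the integration proof of **de Rham's theorem** (Bredon, *Topology and Geometry*
(1993), §V.9, Lemma V.9.2: "for a convex open set `U ⊂ ℝⁿ`, `H*_{smooth}(U) = H*(point)`", via the
straight-line contraction and the prism operator; Lee (2013), proof of Thm. 18.7, Step 1).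

For a chart-convex subset `U = chartSet I p C` of a manifold (`C` convex in the target of the
chart at `p`, `Literature.Geometry.Kaehler.chartSet`) and a point `c ∈ C`, the straight-line
contraction *in the chart*, `(x, s) ↦ e⁻¹((1 - s) e(x) + s c)` (`chartCone`), is a homotopy on `U`
from the identity to the constant map `e⁻¹ c`. Hatcher's prism operator of this homotopy is built
here **explicitly simplex by simplex** (so that the companion file can prove that it preserves
smooth chains): for a singular `n`-simplex `σ` with image in `U` and a prism vertex map
`θ : Fin (k+1) → Fin (n+1) × Fin 2` (`…SingularHomology.Prism.prismMap`), `prismSimplex σ θ` is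
the singular `k`-simplex `t ↦ e⁻¹((1 - h_θ t) e(σ(a_θ t)) + (h_θ t) c)` where `a_θ = stdSimplex.map (fst ∘ θ)`
and `h_θ t = ∑ⱼ tⱼ ε_{θ j}` are the two components of the affine simplex `[θ] : Δᵏ → Δⁿ × I`. Then

* `prismSimplex_face`, `prismSimplex_of_face`, `prismSimplex_bot`, `prismSimplex_top`: the faces
  of prism simplices, the prism simplices of faces, and the bottom/top are what Hatcher's proof
  says they are (`σ` itself and the constant simplex at `e⁻¹ c`);
* `prismOp`: the linear operator `P : Cₙ(M) → Cₙ₊₁(M)` (junk `0` on simplices not in `U`) and the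
  **prism identity** `∂P + P∂ = κ - 𝟙` on chains in `U` (`prism_identity_succ`,
  `prism_identity_zero`), where `κ` replaces every simplex by the constant one — from the tree's
  universal prism identity `Prism.sum_eq_smul` (`PrismIdentity.lean`, Hatcher Thm. 2.10);
* for any subcomplex `S ≤ C(M; R)` of chains in `U` stable under `P` and containing the constant
  simplices: the dual complex `Hom_R(S, N)` has **zero cohomology in positive degrees**
  (`isZero_homology_dualObj_succ`) and its `0`-cocycles are **constant on points**
  (`cochainHom_zero_cocycle_apply_single`).

The instances `S = C(U)` and `S = Δ^{sm}(U)` (smooth chains) are in the companion file.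

## References

* G. E. Bredon, *Topology and Geometry*, GTM 139 (1993), §IV.16 (prism operator), Lemma V.9.2.
* A. Hatcher, *Algebraic Topology* (2002), Thm. 2.10 and its proof.
* J. M. Lee, *Introduction to Smooth Manifolds*, 2nd ed. (2013), proof of Thm. 18.7.
-/

noncomputable section

-- see "Implementation notes" in `…SingularHomology.SingularChainsConcrete`
set_option backward.isDefEq.respectTransparency false

open scoped Manifold ContDiff Topology
open CategoryTheory Limits Set Literature.AlgebraicTopology.SingularHomology

universe u v

namespace Literature.Geometry.Manifold

/-! ### The affine data of a prism vertex map -/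

section Affine

variable {k n : ℕ}

/-- The base component `Δᵏ → Δⁿ` of the affine simplex of a prism vertex map `θ` (the vertex
`j` goes to the vertex `(θ j).1` of `Δⁿ`). [cite: HatcherAT2002, Thm. 2.10 proof] -/
abbrev prismBase (θ : Fin (k + 1) → Fin (n + 1) × Fin 2) : StdSimplex k → StdSimplex n :=
  stdSimplex.map (Prod.fst ∘ θ)

/-- The height component `Δᵏ → [0, 1]` of the affine simplex of a prism vertex map `θ`:
`h_θ(t) = ∑ⱼ tⱼ ε_{θ j}` (`ε = 0` bottom, `1` top). [cite: HatcherAT2002, Thm. 2.10 proof] -/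
def prismHeight (θ : Fin (k + 1) → Fin (n + 1) × Fin 2) (t : StdSimplex k) : ℝ :=
  ∑ j, t j * (((θ j).2 : Fin 2) : ℕ)

/-- The height is nonnegative. [folklore] -/
theorem prismHeight_nonneg (θ : Fin (k + 1) → Fin (n + 1) × Fin 2) (t : StdSimplex k) :
    0 ≤ prismHeight θ t :=
  Finset.sum_nonneg fun j _ ↦ mul_nonneg (stdSimplex.zero_le t j) (by positivity)

/-- The height is at most `1`. [folklore] -/
theorem prismHeight_le_one (θ : Fin (k + 1) → Fin (n + 1) × Fin 2) (t : StdSimplex k) :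
    prismHeight θ t ≤ 1 := by
  calc prismHeight θ t ≤ ∑ j, t j * 1 := Finset.sum_le_sum fun j _ ↦
          mul_le_mul_of_nonneg_left (by
            have h := ((θ j).2).isLt
            exact_mod_cast Nat.lt_succ_iff.mp h) (stdSimplex.zero_le t j)
    _ = 1 := by rw [← Finset.sum_mul, stdSimplex.sum_eq_one, one_mul]

/-- The height lies in `[0, 1]`. [folklore] -/
theorem prismHeight_mem_Icc (θ : Fin (k + 1) → Fin (n + 1) × Fin 2) (t : StdSimplex k) :
    prismHeight θ t ∈ Icc (0 : ℝ) 1 :=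
  ⟨prismHeight_nonneg θ t, prismHeight_le_one θ t⟩

/-- The height is continuous. [folklore] -/
theorem continuous_prismHeight (θ : Fin (k + 1) → Fin (n + 1) × Fin 2) : Continuous (prismHeight θ) :=
  continuous_finsetSum _ fun j _ ↦
    (((continuous_apply j).comp continuous_subtype_val).mul continuous_const)

/-- The height is natural in the vertex map: `h_θ([f] t) = h_{θ ∘ f}(t)`. [folklore] -/
theorem prismHeight_map {k' : ℕ} (f : Fin (k' + 1) → Fin (k + 1))
    (θ : Fin (k + 1) → Fin (n + 1) × Fin 2) (t : StdSimplex k') :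
    prismHeight θ (stdSimplex.map f t) = prismHeight (θ ∘ f) t := by
  classical
  simp only [prismHeight, stdSimplex.map_coe, FunOnFinite.linearMap_apply_apply, Finset.sum_mul,
    Function.comp_apply]
  rw [← Finset.sum_fiberwise Finset.univ f (fun l ↦ (t : Fin (k' + 1) → ℝ) l * (((θ (f l)).2 : Fin 2) : ℕ))]
  refine Finset.sum_congr rfl fun i _ ↦ Finset.sum_congr rfl fun l hl ↦ ?_
  rw [(Finset.mem_filter.1 hl).2]

/-- The base is natural in the vertex map: `a_θ([f] t) = a_{θ ∘ f}(t)`. [folklore] -/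
theorem prismBase_map {k' : ℕ} (f : Fin (k' + 1) → Fin (k + 1))
    (θ : Fin (k + 1) → Fin (n + 1) × Fin 2) (t : StdSimplex k') :
    prismBase θ (stdSimplex.map f t) = prismBase (θ ∘ f) t := by
  rw [prismBase, prismBase, stdSimplex.map_comp_apply]
  rfl

/-- On the bottom vertex map the height is `0`. [folklore] -/
@[simp]
theorem prismHeight_bot (t : StdSimplex n) : prismHeight (Prism.bot n) t = 0 := by
  simp [prismHeight]

/-- On the top vertex map the height is `1`. [folklore] -/
@[simp]
theorem prismHeight_top (t : StdSimplex n) : prismHeight (Prism.top n) t = 1 := by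
  simp [prismHeight, stdSimplex.sum_eq_one]

/-- On the bottom vertex map the base is the identity. [folklore] -/
@[simp]
theorem prismBase_bot (t : StdSimplex n) : prismBase (Prism.bot n) t = t := by
  change stdSimplex.map id t = t
  exact stdSimplex.map_id_apply t

/-- On the top vertex map the base is the identity. [folklore] -/
@[simp]
theorem prismBase_top (t : StdSimplex n) : prismBase (Prism.top n) t = t := by
  change stdSimplex.map id t = t
  exact stdSimplex.map_id_apply t

end Affine

/-! ### The straight-line contraction in a chart -/

section Cone

variable {E : Type u} [NormedAddCommGroup E] [NormedSpace ℝ E]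
  {H : Type*} [TopologicalSpace H] (I : ModelWithCorners ℝ E H)
  {M : Type u} [TopologicalSpace M] [ChartedSpace H M]

/-- **The straight-line contraction in the chart at `p` towards the chart point `c`**:
`(x, s) ↦ e⁻¹((1 - s) e(x) + s c)`, `e = extChartAt I p` (Bredon (1993), Lemma V.9.2, the
homotopy contracting a convex set). [cite: Bredon1993, Lemma V.9.2] -/
def chartCone (p : M) (c : E) (x : M) (s : ℝ) : M :=
  (extChartAt I p).symm ((1 - s) • extChartAt I p x + s • c)

variable {I}

/-- At time `0` the contraction is the identity on the chart source. [folklore] -/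
theorem chartCone_zero (p : M) (c : E) {x : M} (hx : x ∈ (extChartAt I p).source) :
    chartCone I p c x 0 = x := by
  simp only [chartCone, sub_zero, one_smul, zero_smul, add_zero]
  exact (extChartAt I p).left_inv hx

/-- At time `1` the contraction is the constant `e⁻¹ c`. [folklore] -/
theorem chartCone_one (p : M) (c : E) (x : M) : chartCone I p c x 1 = (extChartAt I p).symm c := by
  simp [chartCone]

/-- The chart value along the contraction stays in the convex set `C`. [folklore] -/
theorem chartCone_arg_mem (p : M) {C : Set E} (hCc : Convex ℝ C) {c : E} (hc : c ∈ C) {x : M}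
    (hx : x ∈ Literature.Geometry.Kaehler.chartSet I p C) {s : ℝ} (hs : s ∈ Icc (0 : ℝ) 1) :
    (1 - s) • extChartAt I p x + s • c ∈ C :=
  hCc hx.2 hc (by linarith [hs.2]) hs.1 (by ring)

/-- **The contraction stays in the chart-convex set** `chartSet I p C` for `C` convex,
`c ∈ C ⊆ e.target` and times in `[0, 1]`. [cite: Bredon1993, Lemma V.9.2] -/
theorem chartCone_mem_chartSet (p : M) {C : Set E} (hCc : Convex ℝ C) (hCT : C ⊆ (extChartAt I p).target)
    {c : E} (hc : c ∈ C) {x : M} (hx : x ∈ Literature.Geometry.Kaehler.chartSet I p C) {s : ℝ}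
    (hs : s ∈ Icc (0 : ℝ) 1) : chartCone I p c x s ∈ Literature.Geometry.Kaehler.chartSet I p C := by
  have hm := chartCone_arg_mem p hCc hc hx hs
  refine ⟨(extChartAt I p).map_target (hCT hm), ?_⟩
  change extChartAt I p ((extChartAt I p).symm _) ∈ C
  rwa [(extChartAt I p).right_inv (hCT hm)]

end Cone

/-! ### Prism simplices -/

section PrismSimplex

variable {E : Type u} [NormedAddCommGroup E] [NormedSpace ℝ E]
  {H : Type*} [TopologicalSpace H] {I : ModelWithCorners ℝ E H}
  {M : Type u} [TopologicalSpace M] [ChartedSpace H M]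
  {p : M} {C : Set E} {c : E} {n k : ℕ}

open Literature.Geometry.Kaehler (chartSet)

/-- The parametrisation of the prism simplex of `σ` along the vertex map `θ`:
`t ↦ e⁻¹((1 - h_θ t) e(σ(a_θ t)) + (h_θ t) c)`. [cite: HatcherAT2002, Thm. 2.10 proof] -/
def prismFun (I : ModelWithCorners ℝ E H) (p : M) (c : E) (σ : SingularSimplex M n)
    (θ : Fin (k + 1) → Fin (n + 1) × Fin 2) (t : StdSimplex k) : M :=
  chartCone I p c (SingularSimplex.toContinuousMap σ (prismBase θ t)) (prismHeight θ t)

/-- The prism parametrisation is continuous when `σ` has image in the chart-convex set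
(`e⁻¹` is only continuous on `e.target ⊇ C`). [folklore] -/
theorem continuous_prismFun (hCc : Convex ℝ C) (hCT : C ⊆ (extChartAt I p).target) (hc : c ∈ C)
    {σ : SingularSimplex M n} (hσ : σ.range ⊆ chartSet I p C)
    (θ : Fin (k + 1) → Fin (n + 1) × Fin 2) : Continuous (prismFun I p c σ θ) := by
  have hmem : ∀ t, SingularSimplex.toContinuousMap σ (prismBase θ t) ∈ chartSet I p C :=
    fun t ↦ hσ ⟨_, rfl⟩
  have harg : Continuous fun t : StdSimplex k ↦
      (1 - prismHeight θ t) • extChartAt I p (SingularSimplex.toContinuousMap σ (prismBase θ t)) +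
        prismHeight θ t • c := by
    refine ((continuous_const.sub (continuous_prismHeight θ)).smul ?_).add
      ((continuous_prismHeight θ).smul continuous_const)
    have h1 : Continuous fun t : StdSimplex k ↦ SingularSimplex.toContinuousMap σ (prismBase θ t) :=
      (SingularSimplex.toContinuousMap σ).continuous.comp (stdSimplex.continuous_map _)
    exact (continuousOn_extChartAt p).comp_continuous h1 fun t ↦ (hmem t).1
  exact (continuousOn_extChartAt_symm p).comp_continuous harg fun t ↦
    hCT (chartCone_arg_mem p hCc hc (hmem t) (prismHeight_mem_Icc θ t))

/-- **The prism simplex** of a singular `n`-simplex `σ` with image in the chart-convex set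
`chartSet I p C`, along the prism vertex map `θ : Fin (k+1) → Fin (n+1) × Fin 2`: Hatcher's
`F ∘ (σ × 𝟙) ∘ [θ]` for the straight-line contraction `F` in the chart (Hatcher (2002), proof of
Thm. 2.10; Bredon (1993), Lemma V.9.2). [cite: HatcherAT2002, Thm. 2.10 proof] -/
def prismSimplex (hCc : Convex ℝ C) (hCT : C ⊆ (extChartAt I p).target) (hc : c ∈ C)
    (σ : SingularSimplex M n) (hσ : σ.range ⊆ chartSet I p C)
    (θ : Fin (k + 1) → Fin (n + 1) × Fin 2) : SingularSimplex M k :=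
  SingularSimplex.toContinuousMap.symm ⟨prismFun I p c σ θ, continuous_prismFun hCc hCT hc hσ θ⟩

variable (hCc : Convex ℝ C) (hCT : C ⊆ (extChartAt I p).target) (hc : c ∈ C)

/-- The parametrisation of a prism simplex. [folklore] -/
@[simp]
theorem toContinuousMap_prismSimplex_apply {σ : SingularSimplex M n} (hσ : σ.range ⊆ chartSet I p C)
    (θ : Fin (k + 1) → Fin (n + 1) × Fin 2) (t : StdSimplex k) :
    SingularSimplex.toContinuousMap (prismSimplex hCc hCT hc σ hσ θ) t = prismFun I p c σ θ t := by
  rw [prismSimplex, Equiv.apply_symm_apply]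
  rfl

/-- **Faces of prism simplices are prism simplices**: `dⱼ (σ_θ) = σ_{θ ∘ δⱼ}` (Hatcher (2002),
proof of Thm. 2.10, the terms of `∂P(σ)`). [cite: HatcherAT2002, Thm. 2.10 proof] -/
theorem prismSimplex_face {σ : SingularSimplex M n} (hσ : σ.range ⊆ chartSet I p C)
    (θ : Fin (k + 2) → Fin (n + 1) × Fin 2) (j : Fin (k + 2)) :
    (prismSimplex hCc hCT hc σ hσ θ).face j = prismSimplex hCc hCT hc σ hσ (θ ∘ Fin.succAbove j) := by
  apply SingularSimplex.toContinuousMap_injective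
  ext t
  rw [SingularSimplex.toContinuousMap_face, ContinuousMap.comp_apply, toContinuousMap_prismSimplex_apply,
    toContinuousMap_prismSimplex_apply]
  change prismFun I p c σ θ (stdSimplex.map (Fin.succAbove j) t) = _
  simp only [prismFun, prismHeight_map, prismBase_map]

/-- The image of a face of a simplex in `U` is in `U`. [folklore] -/
theorem face_range_subset {U : Set M} {σ : SingularSimplex M (n + 1)} (hσ : σ.range ⊆ U)
    (l : Fin (n + 2)) : (σ.face l).range ⊆ U :=
  (SingularSimplex.range_face_subset l σ).trans hσ

/-- **Prism simplices of faces**: the prism simplex of `d_l σ` along `θ'` is the prism simplex of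
`σ` along `(δ_l × 𝟙) ∘ θ'` (Hatcher (2002), proof of Thm. 2.10, the terms of `P(∂σ)`).
[cite: HatcherAT2002, Thm. 2.10 proof] -/
theorem prismSimplex_of_face {σ : SingularSimplex M (n + 1)} (hσ : σ.range ⊆ chartSet I p C)
    (l : Fin (n + 2)) (θ' : Fin (k + 1) → Fin (n + 1) × Fin 2) :
    prismSimplex hCc hCT hc (σ.face l) (face_range_subset hσ l) θ' =
      prismSimplex hCc hCT hc σ hσ (Prod.map (Fin.succAbove l) id ∘ θ') := by
  apply SingularSimplex.toContinuousMap_injective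
  ext t
  rw [toContinuousMap_prismSimplex_apply, toContinuousMap_prismSimplex_apply]
  simp only [prismFun, prismHeight, prismBase, SingularSimplex.toContinuousMap_face,
    ContinuousMap.comp_apply, ContinuousMap.coe_mk, stdSimplex.map_comp_apply, Function.comp_apply,
    Prod.map_snd, id_eq]
  rfl

/-- **The bottom of the prism is `σ`** (Hatcher (2002), proof of Thm. 2.10: "`-F ∘ (σ × 𝟙)|[v₀,…,vₙ]`,
which is `-f ∘ σ`", here `f = 𝟙`). [cite: HatcherAT2002, Thm. 2.10 proof] -/
theorem prismSimplex_bot {σ : SingularSimplex M n} (hσ : σ.range ⊆ chartSet I p C) :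
    prismSimplex hCc hCT hc σ hσ (Prism.bot n) = σ := by
  apply SingularSimplex.toContinuousMap_injective
  ext t
  rw [toContinuousMap_prismSimplex_apply, prismFun, prismHeight_bot, prismBase_bot]
  exact chartCone_zero p c (hσ ⟨t, rfl⟩).1

/-- **The top of the prism is the constant simplex at `e⁻¹ c`** (Hatcher (2002), proof of
Thm. 2.10: "`F ∘ (σ × 𝟙)|[w₀,…,wₙ]`, which is `g ∘ σ`", here `g` the constant map). [cite: HatcherAT2002, Thm. 2.10 proof] -/
theorem prismSimplex_top {σ : SingularSimplex M n} (hσ : σ.range ⊆ chartSet I p C) :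
    prismSimplex hCc hCT hc σ hσ (Prism.top n) = SingularSimplex.constAt ((extChartAt I p).symm c) n := by
  apply SingularSimplex.toContinuousMap_injective
  ext t
  rw [toContinuousMap_prismSimplex_apply, prismFun, prismHeight_top, SingularSimplex.toContinuousMap_constAt_apply]
  exact chartCone_one p c _

/-- **Prism simplices stay in the chart-convex set.** [cite: Bredon1993, Lemma V.9.2] -/
theorem range_prismSimplex_subset {σ : SingularSimplex M n} (hσ : σ.range ⊆ chartSet I p C)
    (θ : Fin (k + 1) → Fin (n + 1) × Fin 2) :
    (prismSimplex hCc hCT hc σ hσ θ).range ⊆ chartSet I p C := by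
  rintro _ ⟨t, rfl⟩
  rw [toContinuousMap_prismSimplex_apply]
  exact chartCone_mem_chartSet p hCc hCT hc (hσ ⟨_, rfl⟩) (prismHeight_mem_Icc θ t)

include hCT hc in
/-- The constant simplex at `e⁻¹ c` lies in the chart-convex set (when `c ∈ C ⊆ e.target`). [folklore] -/
theorem range_constAt_symm_subset (n : ℕ) :
    (SingularSimplex.constAt ((extChartAt I p).symm c) n).range ⊆ chartSet I p C := by
  rw [SingularSimplex.range_constAt, singleton_subset_iff]
  refine ⟨(extChartAt I p).map_target (hCT hc), ?_⟩
  change extChartAt I p ((extChartAt I p).symm c) ∈ C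
  rwa [(extChartAt I p).right_inv (hCT hc)]

end PrismSimplex

/-! ### The prism operator and the prism identity -/

section Operator

variable {E : Type u} [NormedAddCommGroup E] [NormedSpace ℝ E]
  {H : Type*} [TopologicalSpace H] {I : ModelWithCorners ℝ E H}
  {M : Type u} [TopologicalSpace M] [ChartedSpace H M]
  {p : M} {C : Set E} {c : E}
  (hCc : Convex ℝ C) (hCT : C ⊆ (extChartAt I p).target) (hc : c ∈ C)
  (R : Type v) [CommRing R] (A : Type v) [AddCommGroup A] [Module R A]

open Literature.Geometry.Kaehler (chartSet)

open Classical in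
/-- **The prism operator `P : Cₙ(M; A) → Cₙ₊₁(M; A)` of the chart contraction**:
`P(a σ) = ∑ᵢ (-1)ⁱ a σ_{θᵢ}` over Hatcher's prism vertex maps `θᵢ = prismMap n i`, for simplices
`σ` with image in the chart-convex set (and `0`, a junk value, on the others). Hatcher (2002),
proof of Thm. 2.10; Bredon (1993), §IV.16. [cite: HatcherAT2002, Thm. 2.10 proof] -/
def prismOp (n : ℕ) : CChain A M n →ₗ[R] CChain A M (n + 1) :=
  Finsupp.lsum R fun σ : SingularSimplex M n ↦
    if h : σ.range ⊆ chartSet I p C then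
      ∑ i : Fin (n + 1), ((-1 : R) ^ (i : ℕ)) •
        Finsupp.lsingle (prismSimplex hCc hCT hc σ h (Prism.prismMap n i))
    else 0

variable {R A}

/-- The prism operator on an elementary chain in the chart-convex set. [cite: HatcherAT2002, Thm. 2.10 proof] -/
theorem prismOp_single {n : ℕ} {σ : SingularSimplex M n} (hσ : σ.range ⊆ chartSet I p C) (a : A) :
    prismOp hCc hCT hc R A n (Finsupp.single σ a) =
      ∑ i : Fin (n + 1), ((-1 : R) ^ (i : ℕ)) •
        Finsupp.single (prismSimplex hCc hCT hc σ hσ (Prism.prismMap n i)) a := by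
  rw [prismOp, Finsupp.lsum_single, dif_pos hσ, LinearMap.sum_apply]
  refine Finset.sum_congr rfl fun i _ ↦ ?_
  rw [LinearMap.smul_apply, Finsupp.lsingle_apply]

/-- The prism operator vanishes (junk) on simplices not in the chart-convex set. [folklore] -/
theorem prismOp_single_of_not {n : ℕ} {σ : SingularSimplex M n} (hσ : ¬σ.range ⊆ chartSet I p C)
    (a : A) : prismOp hCc hCT hc R A n (Finsupp.single σ a) = 0 := by
  rw [prismOp, Finsupp.lsum_single, dif_neg hσ, LinearMap.zero_apply]

/-- **The prism operator preserves chains in the chart-convex set.** [cite: Bredon1993, Lemma V.9.2] -/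
theorem prismOp_mem_chainsIn {n : ℕ} {x : CChain A M n} (hx : x ∈ chainsIn R A M (chartSet I p C) n) :
    prismOp hCc hCT hc R A n x ∈ chainsIn R A M (chartSet I p C) (n + 1) := by
  rw [← Finsupp.sum_single x, Finsupp.sum, map_sum]
  refine Submodule.sum_mem _ fun σ hσ ↦ ?_
  rw [prismOp_single hCc hCT hc ((mem_chainsIn_iff R A x).1 hx σ hσ)]
  exact Submodule.sum_mem _ fun i _ ↦ Submodule.smul_mem _ _
    (single_mem_chainsIn R A (range_prismSimplex_subset hCc hCT hc _ _) _)

variable (R A) in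
/-- **The constant-simplex operator `κ`**: every simplex is replaced by the constant simplex at
`q` (the chain map induced by the constant map, Hatcher (2002), proof of Thm. 2.10 with
`g = const`). [cite: HatcherAT2002, Thm. 2.10 proof] -/
def coneOp (q : M) (n : ℕ) : CChain A M n →ₗ[R] CChain A M n :=
  Finsupp.lsum R fun _ : SingularSimplex M n ↦ Finsupp.lsingle (SingularSimplex.constAt q n)

/-- `κ` on an elementary chain. [folklore] -/
@[simp]
theorem coneOp_single (q : M) {n : ℕ} (σ : SingularSimplex M n) (a : A) :
    coneOp R A q n (Finsupp.single σ a) = Finsupp.single (SingularSimplex.constAt q n) a := by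
  rw [coneOp, Finsupp.lsum_single, Finsupp.lsingle_apply]

/-- `κ` takes values in the chains of any set containing `q`. [folklore] -/
theorem coneOp_mem_chainsIn {U : Set M} {q : M} (hq : q ∈ U) {n : ℕ} (x : CChain A M n) :
    coneOp R A q n x ∈ chainsIn R A M U n := by
  rw [← Finsupp.sum_single x, Finsupp.sum, map_sum]
  refine Submodule.sum_mem _ fun σ _ ↦ ?_
  rw [coneOp_single]
  exact single_mem_chainsIn R A (by rw [SingularSimplex.range_constAt, singleton_subset_iff]; exact hq) _

/-- **The prism identity on an elementary chain, positive dimension**: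
`∂P(aσ) + P∂(aσ) = a κ(σ) - a σ` for `σ` an `(m+1)`-simplex in the chart-convex set — the tree's
universal prism identity `Prism.sum_eq_smul` applied to `θ ↦ a σ_θ` (Hatcher (2002), proof of
Thm. 2.10). [cite: HatcherAT2002, Thm. 2.10 proof] -/
theorem prism_identity_single_succ {m : ℕ} {σ : SingularSimplex M (m + 1)}
    (hσ : σ.range ⊆ chartSet I p C) (a : A) :
    csingularChainComplex.bd R (m + 1) (prismOp hCc hCT hc R A (m + 1) (Finsupp.single σ a)) +
        prismOp hCc hCT hc R A m (csingularChainComplex.bd R m (Finsupp.single σ a)) =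
      Finsupp.single (SingularSimplex.constAt ((extChartAt I p).symm c) (m + 1)) a - Finsupp.single σ a := by
  have key := Prism.sum_eq_smul R (M := CChain A M (m + 1))
    (fun θ ↦ Finsupp.single (prismSimplex hCc hCT hc σ hσ θ) a)
  rw [prismSimplex_top, prismSimplex_bot] at key
  rw [← key]
  congr 1
  · rw [prismOp_single hCc hCT hc hσ, map_sum]
    refine Finset.sum_congr rfl fun i _ ↦ ?_
    rw [map_smul, csingularChainComplex.bd_single, Finset.smul_sum]
    refine Finset.sum_congr rfl fun j _ ↦ ?_
    rw [prismSimplex_face]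
  · rw [csingularChainComplex.bd_single, map_sum]
    refine Finset.sum_congr rfl fun l _ ↦ ?_
    rw [map_smul, prismOp_single hCc hCT hc (face_range_subset hσ l), Finset.smul_sum]
    refine Finset.sum_congr rfl fun i _ ↦ ?_
    rw [prismSimplex_of_face]

/-- **The prism identity on an elementary chain, dimension `0`**: `∂P(aσ) = a κ(σ) - a σ` (the
prism on a vertex is the segment to the cone point). [cite: HatcherAT2002, Thm. 2.10 proof] -/
theorem prism_identity_single_zero {σ : SingularSimplex M 0} (hσ : σ.range ⊆ chartSet I p C) (a : A) :
    csingularChainComplex.bd R 0 (prismOp hCc hCT hc R A 0 (Finsupp.single σ a)) =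
      Finsupp.single (SingularSimplex.constAt ((extChartAt I p).symm c) 0) a - Finsupp.single σ a := by
  have key := Prism.sum_eq_dim_zero R (M := CChain A M 0)
    (fun θ ↦ Finsupp.single (prismSimplex hCc hCT hc σ hσ θ) a)
  rw [prismSimplex_top, prismSimplex_bot] at key
  rw [← key, prismOp_single hCc hCT hc hσ, Fin.sum_univ_one, Fin.val_zero, pow_zero, one_smul,
    csingularChainComplex.bd_single]
  refine Finset.sum_congr rfl fun j _ ↦ ?_
  rw [prismSimplex_face]

/-- **The prism identity `∂P + P∂ = κ - 𝟙` on chains in the chart-convex set, positive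
dimension** (Hatcher (2002), Thm. 2.10; Bredon (1993), §IV.16). [cite: HatcherAT2002, Thm. 2.10] -/
theorem prism_identity_succ {m : ℕ} {x : CChain A M (m + 1)}
    (hx : x ∈ chainsIn R A M (chartSet I p C) (m + 1)) :
    csingularChainComplex.bd R (m + 1) (prismOp hCc hCT hc R A (m + 1) x) +
        prismOp hCc hCT hc R A m (csingularChainComplex.bd R m x) =
      coneOp R A ((extChartAt I p).symm c) (m + 1) x - x := by
  have hgood := (mem_chainsIn_iff R A x).1 hx
  conv => rw [← Finsupp.sum_single x]
  simp only [Finsupp.sum, map_sum, ← Finset.sum_add_distrib, ← Finset.sum_sub_distrib]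
  refine Finset.sum_congr rfl fun σ hσ ↦ ?_
  rw [coneOp_single]
  exact prism_identity_single_succ hCc hCT hc (hgood σ hσ) _

/-- **The prism identity in dimension `0`**: `∂P = κ - 𝟙` on `0`-chains in the chart-convex set. [cite: HatcherAT2002, Thm. 2.10] -/
theorem prism_identity_zero {x : CChain A M 0} (hx : x ∈ chainsIn R A M (chartSet I p C) 0) :
    csingularChainComplex.bd R 0 (prismOp hCc hCT hc R A 0 x) =
      coneOp R A ((extChartAt I p).symm c) 0 x - x := by
  have hgood := (mem_chainsIn_iff R A x).1 hx
  conv => rw [← Finsupp.sum_single x]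
  simp only [Finsupp.sum, map_sum, ← Finset.sum_sub_distrib]
  refine Finset.sum_congr rfl fun σ hσ ↦ ?_
  rw [coneOp_single]
  exact prism_identity_single_zero hCc hCT hc (hgood σ hσ) _

/-! ### The coefficient sum and the parity of `∂` on constant chains -/

/-- `κ(x) = (∑ a_σ) • κ(1)`: the constant-simplex operator factors through the coefficient sum
(the augmentation `Compression.coeffSum` of `…SingularHomology.HurewiczCompression`). [folklore] -/
theorem coneOp_eq_coeffSum_smul (q : M) {n : ℕ} (x : CChain R M n) :
    coneOp R R q n x = Compression.coeffSum R n x • Finsupp.single (SingularSimplex.constAt q n) (1 : R) := by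
  have h : coneOp R R q n =
      (Compression.coeffSum R n).smulRight (Finsupp.single (SingularSimplex.constAt q n) (1 : R)) := by
    refine Finsupp.lhom_ext fun σ r ↦ ?_
    rw [coneOp_single, LinearMap.smulRight_apply, Compression.coeffSum_single, Finsupp.smul_single_one]
  rw [h, LinearMap.smulRight_apply]

/-- Parity of `n` and of `n + 2` agree. [folklore] -/
theorem even_add_two_iff (n : ℕ) : Even (n + 2) ↔ Even n :=
  ⟨fun ⟨r, hr⟩ ↦ ⟨r - 1, by omega⟩, fun ⟨r, hr⟩ ↦ ⟨r + 1, by omega⟩⟩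

/-- **Parity of the coefficient sum of a boundary**: `aug(∂x) = 0` from odd dimension (even
number of faces) and `aug(∂x) = aug(x)` from even dimension (via the tree's
`sum_neg_one_pow_fin`). [folklore] -/
theorem coeffSum_bd {n : ℕ} (x : CChain R M (n + 1)) :
    Compression.coeffSum R n (csingularChainComplex.bd R n x) =
      if Even n then 0 else Compression.coeffSum R (n + 1) x := by
  have h : (Compression.coeffSum R n : CChain R M n →ₗ[R] R) ∘ₗ csingularChainComplex.bd R n =
      if Even n then 0 else Compression.coeffSum R (n + 1) := by
    refine Finsupp.lhom_ext fun σ a ↦ ?_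
    rw [LinearMap.comp_apply, csingularChainComplex.bd_single, map_sum]
    simp only [map_smul, Compression.coeffSum_single, ← Finset.sum_smul, sum_neg_one_pow_fin (R := R) (n + 1),
      even_add_two_iff]
    by_cases hn : Even n
    · rw [if_pos hn, if_pos hn, zero_smul, LinearMap.zero_apply]
    · rw [if_neg hn, if_neg hn, one_smul, Compression.coeffSum_single]
  have h' := LinearMap.congr_fun h x
  rw [LinearMap.comp_apply] at h'
  rw [h']
  split_ifs <;> rfl

/-- The boundary of the constant `(n+1)`-simplex is `κₙ` or `0` according to the parity of `n`
(the tree's `Compression.bd_single_constSimplex`, restated for `SingularSimplex.constAt` in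
`if`-normal form). [folklore] -/
theorem bd_single_constAt (q : M) (n : ℕ) (a : R) :
    csingularChainComplex.bd R n (Finsupp.single (SingularSimplex.constAt q (n + 1)) a) =
      if Even n then 0 else Finsupp.single (SingularSimplex.constAt q n) a := by
  rw [SingularSimplex.constAt_eq_constSimplex, SingularSimplex.constAt_eq_constSimplex,
    Compression.bd_single_constSimplex]
  by_cases hn : Even n
  · rw [if_pos ((even_add_two_iff n).2 hn), if_pos hn, zero_smul]
  · rw [if_neg (fun h ↦ hn ((even_add_two_iff n).1 h)), if_neg hn, one_smul]

end Operator

/-! ### Cohomology of a prism-stable subcomplex of chains in the chart-convex set -/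

section Cohomology

variable {E : Type u} [NormedAddCommGroup E] [NormedSpace ℝ E]
  {H : Type*} [TopologicalSpace H] {I : ModelWithCorners ℝ E H}
  {M : Type u} [TopologicalSpace M] [ChartedSpace H M]
  {p : M} {C : Set E} {c : E}
  (hCc : Convex ℝ C) (hCT : C ⊆ (extChartAt I p).target) (hc : c ∈ C)
  {R : Type v} [CommRing R] (N : ModuleCat.{max u v} R)
  (S : Subcomplex (csingularChainComplex R R M))
  (hS : ∀ n, S n ≤ chainsIn R R M (Literature.Geometry.Kaehler.chartSet I p C) n)
  (hP : ∀ (n : ℕ) (x : CChain R M n), x ∈ S n → prismOp hCc hCT hc R R n x ∈ S (n + 1))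
  (hconst : ∀ n, Finsupp.single (SingularSimplex.constAt ((extChartAt I p).symm c) n) (1 : R) ∈ S n)

/-- The prism operator restricted to the subcomplex, as a linear map. [folklore] -/
def prismOpSub (n : ℕ) : ↥(S n) →ₗ[R] ↥(S (n + 1)) :=
  ((prismOp hCc hCT hc R R n).domRestrict (S n)).codRestrict (S (n + 1)) fun z ↦ hP n z.1 z.2

/-- Value of the restricted prism operator. [folklore] -/
@[simp]
theorem prismOpSub_apply_val (n : ℕ) (z : ↥(S n)) :
    (prismOpSub hCc hCT hc S hP n z).1 = prismOp hCc hCT hc R R n z.1 :=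
  rfl

include hconst in
/-- `κ` preserves the subcomplex (it factors through the augmentation). [folklore] -/
theorem coneOp_mem (n : ℕ) (x : CChain R M n) :
    coneOp R R ((extChartAt I p).symm c) n x ∈ S n := by
  rw [coneOp_eq_coeffSum_smul]
  exact Submodule.smul_mem _ _ (hconst n)

/-- The boundary of the subcomplex in consecutive degrees, as a linear map (`bd` restricted). [folklore] -/
def bdSub (n : ℕ) : ↥(S (n + 1)) →ₗ[R] ↥(S n) :=
  ((csingularChainComplex.bd R n).domRestrict (S (n + 1))).codRestrict (S n) fun z ↦ by
    have h := S.d_mem (i := n + 1) (j := n) z.2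
    rwa [csingularChainComplex.d_apply] at h

/-- Value of the restricted boundary. [folklore] -/
@[simp]
theorem bdSub_apply_val (n : ℕ) (z : ↥(S (n + 1))) :
    (bdSub S n z).1 = csingularChainComplex.bd R n z.1 :=
  rfl

/-- The differential of `S.toComplex` is the restricted boundary. [folklore] -/
theorem toComplex_d_eq_bdSub (n : ℕ) (z : S.toComplex.X (n + 1)) :
    S.toComplex.d (n + 1) n z = bdSub S n z :=
  Subtype.ext (toComplex_d_val R R S n z)

include hS in
/-- **The prism identity inside the subcomplex**, positive degree:
`P(∂z) = aug(z) κ(1) - z - ∂(P z)` in `S_{k+1}`. [cite: HatcherAT2002, Thm. 2.10] -/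
theorem prismOpSub_bdSub (k : ℕ) (z : ↥(S (k + 1))) :
    prismOpSub hCc hCT hc S hP k (bdSub S k z) =
      Compression.coeffSum R (k + 1) z.1 • ⟨_, hconst (k + 1)⟩ - z -
        bdSub S (k + 1) (prismOpSub hCc hCT hc S hP (k + 1) z) := by
  apply Subtype.ext
  have hz : (z.1 : CChain R M (k + 1)) ∈ chainsIn R R M (Literature.Geometry.Kaehler.chartSet I p C) (k + 1) :=
    hS (k + 1) z.2
  have key := prism_identity_succ hCc hCT hc (R := R) (A := R) hz
  rw [coneOp_eq_coeffSum_smul] at key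
  rw [Submodule.coe_sub, Submodule.coe_sub, Submodule.coe_smul, bdSub_apply_val, prismOpSub_apply_val,
    prismOpSub_apply_val, bdSub_apply_val, ← key]
  abel

include hS in
/-- **The prism identity inside the subcomplex**, degree `0`: `z = aug(z) κ₀(1) - ∂(P z)` in `S₀`. [cite: HatcherAT2002, Thm. 2.10] -/
theorem eq_coeffSum_smul_sub_bdSub (z : ↥(S 0)) :
    z = Compression.coeffSum R 0 z.1 • ⟨_, hconst 0⟩ - bdSub S 0 (prismOpSub hCc hCT hc S hP 0 z) := by
  apply Subtype.ext
  have hz : (z.1 : CChain R M 0) ∈ chainsIn R R M (Literature.Geometry.Kaehler.chartSet I p C) 0 := hS 0 z.2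
  have key := prism_identity_zero hCc hCT hc (R := R) (A := R) hz
  rw [coneOp_eq_coeffSum_smul] at key
  rw [Submodule.coe_sub, Submodule.coe_smul, bdSub_apply_val, prismOpSub_apply_val, key, sub_sub_cancel]

/-- A cochain of the dual complex, as the linear map `S_j → N` it is. [folklore] -/
abbrev cochainHom {j : ℕ} (φ : (dualObj R N S.toComplex).X j) : ↥(S j) →ₗ[R] N :=
  ModuleCat.Hom.hom (φ : S.toComplex.X j ⟶ N)

/-- The cocycle condition `d* φ = 0` applied to an element: `φ(∂w) = 0`. [folklore] -/
theorem cochainHom_bdSub_eq_zero {j : ℕ} (φ : (dualObj R N S.toComplex).X j)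
    (hφ : (dualObj R N S.toComplex).d j (j + 1) φ = 0) (w : ↥(S (j + 1))) :
    cochainHom N S φ (bdSub S j w) = 0 := by
  rw [dualObj_d_apply] at hφ
  have h := congrArg (fun ψ : S.toComplex.X (j + 1) ⟶ N ↦ ModuleCat.Hom.hom ψ w) hφ
  simp only [ModuleCat.hom_comp, LinearMap.comp_apply, ModuleCat.hom_zero, LinearMap.zero_apply] at h
  rwa [toComplex_d_eq_bdSub] at h

include hS hP hconst in
/-- **Positive-degree cohomology of a prism-stable subcomplex vanishes.** For a subcomplex `S` of
`C(M; R)` consisting of chains in the chart-convex set, stable under the prism operator and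
containing the constant simplices at the cone point, `Hᵏ⁺¹(Hom_R(S, N)) = 0`: every cocycle `φ`
is the coboundary of `χ - φ ∘ P`, with `χ = 0` or `coeffSum(·) φ(κ(1))` according to the parity of `k`
(dualising the chain homotopy `∂P + P∂ = κ - 𝟙`; Bredon (1993), Lemma V.9.2; Hatcher (2002),
Thm. 2.10 and §3.1 p. 201). [cite: Bredon1993, Lemma V.9.2] -/
theorem isZero_homology_dualObj_succ (k : ℕ) : IsZero ((dualObj R N S.toComplex).homology (k + 1)) := by
  rw [isZero_homology_iff]
  intro φ hφ
  rw [d_next_eq_zero_iff ((ComplexShape.down ℕ).symm.next_eq' (rfl : k + 1 + 1 = k + 2))] at hφ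
  rw [exists_d_prev_eq_iff ((ComplexShape.down ℕ).symm.prev_eq' (rfl : k + 1 = k + 1))]
  -- notation
  set Φ : ↥(S (k + 1)) →ₗ[R] N := cochainHom N S φ with hΦ
  have h0 : ∀ w : ↥(S (k + 2)), Φ (bdSub S (k + 1) w) = 0 := cochainHom_bdSub_eq_zero N S φ hφ
  set φ₀ : N := Φ ⟨_, hconst (k + 1)⟩ with hφ₀
  set χ : ↥(S k) →ₗ[R] N :=
    if Even k then 0 else ((Compression.coeffSum R k).domRestrict (S k)).smulRight φ₀ with hχ
  set ψ : ↥(S k) →ₗ[R] N := χ - Φ ∘ₗ prismOpSub hCc hCT hc S hP k with hψ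
  refine ⟨ModuleCat.ofHom ψ, ?_⟩
  rw [dualObj_d_apply]
  refine ModuleCat.hom_ext (LinearMap.ext fun z ↦ ?_)
  change ψ (S.toComplex.d (k + 1) k z) = Φ z
  rw [toComplex_d_eq_bdSub, hψ, LinearMap.sub_apply, LinearMap.comp_apply,
    prismOpSub_bdSub hCc hCT hc S hS hP hconst, map_sub, map_sub, map_smul, h0, sub_zero]
  -- `φ₀ = 0` when `k` is even (the cocycle condition on the constant `(k+2)`-simplex)
  have h2 : Even k → φ₀ = 0 := fun hk ↦ by
    have h := h0 ⟨_, hconst (k + 2)⟩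
    have hval : bdSub S (k + 1) ⟨_, hconst (k + 2)⟩ = ⟨_, hconst (k + 1)⟩ := by
      apply Subtype.ext
      rw [bdSub_apply_val]
      change csingularChainComplex.bd R (k + 1) (Finsupp.single _ (1 : R)) = Finsupp.single _ 1
      rw [bd_single_constAt, if_neg (by rintro ⟨r, hr⟩; rcases hk with ⟨r', hr'⟩; omega)]
    rwa [hval] at h
  by_cases hk : Even k
  · rw [hχ, if_pos hk, LinearMap.zero_apply, ← hφ₀, h2 hk, smul_zero, zero_sub, zero_sub, neg_neg]
  · rw [hχ, if_neg hk]
    change Compression.coeffSum R k (bdSub S k z).1 • φ₀ -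
        (Compression.coeffSum R (k + 1) z.1 • φ₀ - Φ z) = Φ z
    rw [bdSub_apply_val, coeffSum_bd, if_neg hk]
    abel

include hS hP in
/-- **`0`-cocycles of a prism-stable subcomplex are constant on points**: a `0`-cochain `φ` on
`S` with `∂* φ = 0` satisfies `φ(z) = aug(z) φ(κ₀(1))` (Bredon (1993), Lemma V.9.2, degree `0`).
[cite: Bredon1993, Lemma V.9.2] -/
theorem cochainHom_zero_cocycle_apply (φ : (dualObj R N S.toComplex).X 0)
    (hφ : (dualObj R N S.toComplex).d 0 1 φ = 0) (z : ↥(S 0)) :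
    cochainHom N S φ z = Compression.coeffSum R 0 z.1 • cochainHom N S φ ⟨_, hconst 0⟩ := by
  conv_lhs => rw [eq_coeffSum_smul_sub_bdSub hCc hCT hc S hS hP hconst z]
  rw [map_sub, cochainHom_bdSub_eq_zero N S φ hφ, sub_zero, map_smul]

include hS hP hconst in
/-- The value of a `0`-cocycle on a point of the subcomplex does not depend on the point. [cite: Bredon1993, Lemma V.9.2] -/
theorem cochainHom_zero_cocycle_apply_single (φ : (dualObj R N S.toComplex).X 0)
    (hφ : (dualObj R N S.toComplex).d 0 1 φ = 0) {σ τ : SingularSimplex M 0}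
    (hσ : Finsupp.single σ (1 : R) ∈ S 0) (hτ : Finsupp.single τ (1 : R) ∈ S 0) :
    cochainHom N S φ ⟨Finsupp.single σ 1, hσ⟩ = cochainHom N S φ ⟨Finsupp.single τ 1, hτ⟩ := by
  rw [cochainHom_zero_cocycle_apply hCc hCT hc N S hS hP hconst φ hφ,
    cochainHom_zero_cocycle_apply hCc hCT hc N S hS hP hconst φ hφ ⟨Finsupp.single τ 1, hτ⟩]
  change Compression.coeffSum R 0 (Finsupp.single σ 1) • _ = Compression.coeffSum R 0 (Finsupp.single τ 1) • _
  rw [Compression.coeffSum_single, Compression.coeffSum_single]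

end Cohomology

end Literature.Geometry.Manifold
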